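import Summits.BirchSwinnertonDyer.BirchSwinnertonDyer.Theorems.EisensteinPrimesMazurMCOnX1RankZeroAnalyticMuMinimal
import Summits.BirchSwinnertonDyer.BirchSwinnertonDyer.Theorems.EisensteinPrimesMazurMCOnX1RankZeroAnalyticMuOffLocus
import HarnessLib

/-!
# Crux `MazurMCOnX1RankZero` (stmt-BirchSwinnertonDyer-19035), line `mudescent`, stub
# `stub_analyticMuZero_offLocus` — in a rank-`0` X1 class holding ONE member with `μ_an = 0`, the
# members with `μ_an = 0` are EXACTLY the off-locus members (cell `bsd-eis`, seat `bsd-eis-mu-b`,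
# gen 2; CONSTRUCTION seat, open-problem grade — closes NO stub)

Composition of the two directions now on the tree for the rank-`0` X1 leaf:
* NECESSITY (gen 0, `…X1RankZeroAnalyticMuOffLocus`, p460164): granted Greenberg LNM 1716 Prop. 5.7,
  Wuthrich 2014 Thm. 16 and modularity, `X1.MuPart.AnalyticMuLE W p 0 → ¬ HasRamifiedOddLineAt W p`
  (a ramified rational `p`-line forces every coefficient of `ϖ·L_p` to have norm `≤ p⁻¹`);
* MINIMALITY (gen 2, `…X1RankZeroAnalyticMuMinimal`, p467537): granted modularity, the certificate of
  ANY member transports to every off-locus member of its class (type-A period ladder of seat mu-a).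
Hence (§1) `analyticMuLE_zero_iff_not_hasRamifiedOddLineAt_of_exists_member`: if SOME `W′ ∼ W` has
`μ_an = 0`, then `μ_an(W) = 0 ⟺ W` is off the `μ`-barrier locus; and (§2) the class-wide form: the
registered stub ⟺ «on every rank-`0` X1 class the set of members with `μ_an = 0` is the (non-empty,
by `stub_locate`) set of off-locus members». HONEST FRAMING: theorems only; the three published inputs
enter as displayed hypotheses exactly as in p460164; the stub (= existence of one certified member per
class, Greenberg's Conj. 1.11 in analytic form) stays OPEN; no label or count of the cell moves.
References: [GreenbergLNM1716] Prop. 5.7 (p. 113), Conj. 1.11 (p. 58); [Wuthrich2014] Thm. 16;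
[Stevens1989] (4.12), Rem. 4.14; [BCDTJAMS2001] Thm. A; HOME `run/shared/lean/pub/bsd-eis/mu-b-MEMO-1.md`.
-/

set_option autoImplicit false

-- `Summit.BirchSwinnertonDyer.BirchSwinnertonDyer.…`: the summit and its single sub-problem share a name (D-0017 layout).
set_option linter.dupNamespace false

noncomputable section

open scoped Classical

open WeierstrassCurve
  Literature.NumberTheory.EllipticCurves Literature.NumberTheory.EllipticCurves.ModularForms
  Literature.NumberTheory.EllipticCurves.Rank1Residual
  Literature.NumberTheory.EllipticCurves.Greenberg1999
  Literature.Barriers.BirchSwinnertonDyer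
  Summit.BirchSwinnertonDyer.Rank1Residual
  Summit.BirchSwinnertonDyer.BirchSwinnertonDyer.Theorems
  Summit.BirchSwinnertonDyer.BirchSwinnertonDyer.Theorems.EisensteinPrimesMazurMCOnX1RankZeroAnalyticMuOffLocus
  Summit.BirchSwinnertonDyer.BirchSwinnertonDyer.Theorems.EisensteinPrimesMazurMCOnX1RankZeroAnalyticMuMinimal

namespace Summit.BirchSwinnertonDyer.BirchSwinnertonDyer.Theorems.EisensteinPrimesMazurMCOnX1RankZeroAnalyticMuMinimalLocus

variable {W : WeierstrassCurve ℚ} [W.IsElliptic] [W.IsGloballyMinimal] {p : ℕ} [hp : Fact p.Prime]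

/-! ## §1. One certified member decides `μ_an = 0` for every member of its class -/

/-- **In a rank-`0` X1 class with ONE member of analytic `μ = 0`, the members with `μ_an = 0` are
EXACTLY the off-locus members.** Granted Greenberg LNM 1716 Prop. 5.7 (`h57`), Wuthrich 2014 Thm. 16
(`hW16`) and modularity (`hmod`): if `W′ ∼ W` (globally minimal) has `X1.MuPart.AnalyticMuLE W′ p 0`
and `(W,p)` is rank-`0` X1, then `X1.MuPart.AnalyticMuLE W p 0 ↔ ¬ HasRamifiedOddLineAt W p`.
«→» is gen 0's necessity theorem `not_hasRamifiedOddLineAt_of_leaf_of_analyticMuLE_zero`; «←» is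
the ladder transport `analyticMuLE_offLocus_of_isIsogenous`. Per pair: the census certificate at ANY
member settles `μ_an = 0` member by member for the whole class.
[cite: GreenbergLNM1716, Prop. 5.7 (p. 113) and Conj. 1.11 (p. 58)] [cite: Wuthrich2014, Thm. 16 (p. 397)]
[cite: Stevens1989, (4.12) and Rem. 4.14] -/
theorem analyticMuLE_zero_iff_not_hasRamifiedOddLineAt_of_exists_member
    (h57 : prop57_one_le_mu_of_ramified_odd_line) (hW16 : Wuthrich2014.charIdeal_dvd_padicLFunction)
    (hmod : nonempty_modularParametrizationData) (hX1 : ClassX1 W p) (hr0 : W.analyticRank = 0)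
    {W' : WeierstrassCurve ℚ} [W'.IsElliptic] [W'.IsGloballyMinimal] (hiso : IsIsogenous W W')
    (hμ' : X1.MuPart.AnalyticMuLE W' p 0) :
    X1.MuPart.AnalyticMuLE W p 0 ↔ ¬ HasRamifiedOddLineAt W p :=
  ⟨not_hasRamifiedOddLineAt_of_leaf_of_analyticMuLE_zero h57 hW16 hmod ⟨hX1, hr0⟩,
    fun hoff ↦ analyticMuLE_zero_of_offLocus_of_offLocus hmod hX1 hr0 hoff hiso hμ'⟩

/-- **Two certified members of one rank-`0` X1 class are both off the locus** (and conversely two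
off-locus members are both certified as soon as one is): the set `{μ_an = 0}` and the set «off the
locus» coincide on any class where the former is non-empty. [cite: GreenbergLNM1716, Prop. 5.7 (p. 113)]
[cite: Wuthrich2014, Thm. 16 (p. 397)] -/
theorem not_hasRamifiedOddLineAt_and_of_analyticMuLE_zero_of_analyticMuLE_zero
    (h57 : prop57_one_le_mu_of_ramified_odd_line) (hW16 : Wuthrich2014.charIdeal_dvd_padicLFunction)
    (hmod : nonempty_modularParametrizationData) (hX1 : ClassX1 W p) (hr0 : W.analyticRank = 0)
    {W' : WeierstrassCurve ℚ} [W'.IsElliptic] [W'.IsGloballyMinimal] (hiso : IsIsogenous W W')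
    (hμ : X1.MuPart.AnalyticMuLE W p 0) (hμ' : X1.MuPart.AnalyticMuLE W' p 0) :
    ¬ HasRamifiedOddLineAt W p ∧ ¬ HasRamifiedOddLineAt W' p := by
  obtain hL' : X1.RankZero.Leaf W' p := leaf_of_isIsogenous hX1 hr0 hiso.symm_of_charZero
  exact ⟨not_hasRamifiedOddLineAt_of_leaf_of_analyticMuLE_zero h57 hW16 hmod ⟨hX1, hr0⟩ hμ,
    not_hasRamifiedOddLineAt_of_leaf_of_analyticMuLE_zero h57 hW16 hmod hL' hμ'⟩

/-! ## §2. Class-wide form: the stub ⟺ «{μ_an = 0} = {off the locus} ≠ ∅ on every rank-0 X1 class» -/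

/-- **The registered stub, read as a description of the locus.** Granted Prop. 5.7, Thm. 16 and
modularity, `stub_analyticMuZero_offLocus` (LHS, verbatim) holds iff on every rank-`0` X1 pair
`(W,p)`: `X1.MuPart.AnalyticMuLE W p 0 ↔ ¬ HasRamifiedOddLineAt W p` — «in each rank-`0` X1 class the
members with analytic `μ = 0` are exactly the off-locus members» (a non-empty set by the landed
`stub_locate`, p443510). «⇒»: necessity (p460164) and the stub; «⇐»: specialise at an off-locus
member. [cite: GreenbergLNM1716, Prop. 5.7 (p. 113) and Conj. 1.11 (p. 58)] [cite: Wuthrich2014, Thm. 16 (p. 397)]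
[cite: Stevens1989, Rem. 4.14 (p. 95)] -/
theorem stub_analyticMuZero_offLocus_iff_locus (h57 : prop57_one_le_mu_of_ramified_odd_line)
    (hW16 : Wuthrich2014.charIdeal_dvd_padicLFunction) (hmod : nonempty_modularParametrizationData) :
    (∀ (W₀ : WeierstrassCurve ℚ) [W₀.IsElliptic] [W₀.IsGloballyMinimal] (p : ℕ) [Fact p.Prime],
      ClassX1 W₀ p → W₀.analyticRank = 0 → ¬ HasRamifiedOddLineAt W₀ p →
        X1.MuPart.AnalyticMuLE W₀ p 0) ↔
    (∀ (W : WeierstrassCurve ℚ) [W.IsElliptic] [W.IsGloballyMinimal] (p : ℕ) [Fact p.Prime],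
      ClassX1 W p → W.analyticRank = 0 →
        (X1.MuPart.AnalyticMuLE W p 0 ↔ ¬ HasRamifiedOddLineAt W p)) := by
  constructor
  · intro hstub W _ _ p _ hX1 hr0
    exact ⟨not_hasRamifiedOddLineAt_of_leaf_of_analyticMuLE_zero h57 hW16 hmod ⟨hX1, hr0⟩,
      hstub W p hX1 hr0⟩
  · intro hloc W₀ _ _ p _ hX1 hr0 hoff
    exact (hloc W₀ p hX1 hr0).mpr hoff

end Summit.BirchSwinnertonDyer.BirchSwinnertonDyer.Theorems.EisensteinPrimesMazurMCOnX1RankZeroAnalyticMuMinimalLocus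

end
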